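import Summits.Ventures.Crystal3D.Theorems.StickyWulffConstantTextureLiminfTexShadowCoverageBarlowSteerDefs
import Summits.Ventures.Crystal3D.Theorems.StickyWulffConstantTextureLiminfTexShadowCoverageBarlowAtGlue
import Summits.Ventures.Crystal3D.Theorems.StickyWulffConstantTextureLiminfLineCountGlueOneSidedUp
import Summits.Ventures.Crystal3D.Theorems.StickyWulffConstantGenericWallFloorBarlowOrientedGlueOneSidedTopAtTilt
import HarnessLib

/-!
# TexShadow row (e) / EDGE-ON option (ε): steered certificates ⇒ the cell, and the row-(e) closer over the STEERED menu
# (lane T, crux `TextureLiminfV5`, stmt-Ventures-23912, sub-crux EDGE-ON `stub_edgeOn`; cf-p1 DECISION (ciii)(2); HOME/wall-p2-g11/EPSILON-SIZING.md)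

HONEST FRAMING. Venture `Summits/Ventures/Crystal3D` (cell `crystal3d-full`), route `route-Ventures-StickyWulffConstant`, helper
`--supports` the law-v5 crux `TextureLiminfV5` (stmt-Ventures-23912).  PURE BOOKKEEPING (census-free, standard axioms); every wall input is a
HYPOTHESIS; no certificate is proved or claimed; rung F-C1 not moved.

WHAT.
* `bilayerWallAt_of_barlowUpCertifiedSteer` — `BarlowUpCertifiedSteer c₀ σ₁ L₁ L₂ z v` ⇒ the cell at `C′(R₀) = ((270 + 576R₀) + 80(R₀+9) + 3456 + 1152(R₀+1))/2`
  (`R₀ ≥ 6`) for every table `0 ≤ c ≤ c₀`: lane G's STEERED chosen-slot glue `barlow_hlines_oriented_oneSided_at_tilt` on the up-presentation (flipping plate 1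
  by `basalMirror` if needed, `bilayerWallAt_flip₁`) and wulff-p2's generic one-family cell glue `bilayerWallAt_of_lineCount_oneSided_up` with
  `hdom : c ≤ √2·(e₃-rise of step i)/2`; `bilayerWallAt_of_barlowDownCertifiedSteer` — the mirror (`…_top_at_tilt`, `…_up_top`, `bilayerWallAt_flip₂`);
* `bilayerWallAt_of_barlowMenuSteerCertified` (constant `max` of the two), `faultedOnAt_of_steerCoverageBarlowOn`,
  `residualFaultedCoreAt_of_steerCoverageBarlowOn(')` — steered certificate on `Reg` + core on `Rem` + `Reg ∨ Rem` ⇒ the registered core.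
WHAT THIS IS NOT: no certificate; F-C1 not moved.
-/

noncomputable section

namespace Summit.Ventures.Crystal3D.Cruxes.TextureLiminf.TexShadow

open Summit.Ventures.Crystal3D Summit.Ventures.Crystal3D.Theorems Finset
open Literature.MathematicalPhysics.StatisticalMechanics (IsHaggSeq fccStacking barlowStacking basalMirror)
open scoped InnerProductSpace

/-- `√2·c₀ ≤ r` gives `c₀ ≤ √2·r/2`. -/
private theorem le_sqrt_two_mul_div_two'' {c₀ r : ℝ} (h : Real.sqrt 2 * c₀ ≤ r) : c₀ ≤ Real.sqrt 2 * r / 2 := by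
  have h2 : Real.sqrt 2 * Real.sqrt 2 = 2 := Real.mul_self_sqrt (by norm_num)
  have hnn : 0 ≤ Real.sqrt 2 / 2 * (r - Real.sqrt 2 * c₀) :=
    mul_nonneg (div_nonneg (Real.sqrt_nonneg 2) zero_le_two) (sub_nonneg.2 h)
  have hid : Real.sqrt 2 * r / 2 - c₀ = Real.sqrt 2 / 2 * (r - Real.sqrt 2 * c₀) := by
    linear_combination (c₀ / 2) * h2
  linarith [hid, hnn]

/-! ## Steered certificates ⇒ the cell -/

/-- **Steered UP family certified ⇒ the cell**, for every table `0 ≤ c ≤ c₀` (`R₀ ≥ 6`), in either presentation of plate 1. -/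
theorem bilayerWallAt_of_barlowUpCertifiedSteer {sE : E3} (hsE : sE ∈ fccSlots) (hcert : ExactOnly 0 (fccSlots.filter fun w => 0 < ⟪w, sE⟫_ℝ))
    (hDS : ∀ F₁ F₂ : E3 ≃ₗᵢ[ℝ] E3, DoubleStarCoaxialAt F₁ F₂) (hCP : CapPairCoaxial)
    {σ₁ σ₂ : ℤ → ℤ} (hσ₁ : IsHaggSeq σ₁) (hσ₂ : IsHaggSeq σ₂) (L₁ L₂ : E3 ≃ₗᵢ[ℝ] E3) (s₁ s₂ : E3)
    {c₀ : ℝ} {z v : E3} (hcov : BarlowUpCertifiedSteer c₀ σ₁ L₁ L₂ z v) (R₀ : ℝ) (hR₀ : 6 ≤ R₀)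
    (c : ℤ → ℤ → ℝ) (hc0 : ∀ i j, 0 ≤ c i j) (hcc : ∀ i j, c i j ≤ c₀) :
    BilayerWallAt (((270 + 576 * R₀) + 80 * (R₀ + 9) + 3456 + 1152 * (R₀ + 1)) / 2) R₀ σ₁ σ₂ L₁ L₂ s₁ s₂ c := by
  obtain ⟨hz, hze, hv, hv2, hsteep, hrise, hnab, hapart⟩ := hcov
  have hR₀3 : (3 : ℝ) ≤ R₀ := by linarith
  by_cases hax : 0 ≤ (L₁.symm e₃) 2
  · have hup : upFrame L₁ e₃ = L₁ := by unfold upFrame; rw [if_pos hax]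
    have huw : upWord L₁ σ₁ e₃ = σ₁ := by unfold upWord; rw [if_pos hax]
    rw [hup] at hsteep hrise hnab hapart
    rw [huw] at hnab
    obtain ⟨step₁, hupb, hΔ, hna, hr, hF⟩ := barlow_hlines_oriented_oneSided_at_tilt hsE hcert hDS hCP hσ₁ hσ₂ L₁ L₂ s₁ s₂ hax hz hze
      hv hv2 hsteep (fun m hm => (hnab m hm).1) hapart R₀ hR₀
    refine bilayerWallAt_of_lineCount_oneSided_up hσ₁ hσ₂ L₁ L₂ s₁ s₂ R₀ (270 + 576 * R₀) hR₀3 hax hupb hr c hc0 ?_ hF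
    intro i j
    refine (hcc i j).trans ?_
    rcases hσ₁ i with h1 | h1
    · rw [hΔ i h1, ← inner_map_eq_inner_symm]; exact le_sqrt_two_mul_div_two'' hrise
    · rw [hna i h1, ← inner_map_eq_inner_symm]; exact le_sqrt_two_mul_div_two'' (hnab i h1).2
  · have hup : upFrame L₁ e₃ = basalMirror.trans L₁ := by unfold upFrame; rw [if_neg hax]
    have huw : upWord L₁ σ₁ e₃ = fun n => -σ₁ (-n - 1) := by unfold upWord; rw [if_neg hax]
    rw [hup] at hsteep hrise hnab hapart
    rw [huw] at hnab
    have hσ₁' : IsHaggSeq (fun n => -σ₁ (-n - 1)) := isHaggSeq_reverse hσ₁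
    have hax' : 0 ≤ ((basalMirror.trans L₁).symm e₃) 2 := by
      have h := upFrame_axis_nonneg L₁ e₃
      rwa [hup] at h
    obtain ⟨step₁, hupb, hΔ, hna, hr, hF⟩ := barlow_hlines_oriented_oneSided_at_tilt hsE hcert hDS hCP hσ₁' hσ₂ (basalMirror.trans L₁) L₂ s₁ s₂
      hax' hz hze hv hv2 hsteep (fun m hm => (hnab m hm).1) hapart R₀ hR₀
    have key := bilayerWallAt_of_lineCount_oneSided_up hσ₁' hσ₂ (basalMirror.trans L₁) L₂ s₁ s₂ R₀ (270 + 576 * R₀) hR₀3 hax' hupb hr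
      (fun i j => c (-i - 1) j) (fun i j => hc0 _ _) (fun i j => by
        refine (hcc _ _).trans ?_
        rcases hσ₁' i with h1 | h1
        · rw [hΔ i h1, ← inner_map_eq_inner_symm]; exact le_sqrt_two_mul_div_two'' hrise
        · rw [hna i h1, ← inner_map_eq_inner_symm]; exact le_sqrt_two_mul_div_two'' (hnab i h1).2) hF
    exact bilayerWallAt_flip₁.1 key

/-- **Steered DOWN family certified ⇒ the cell**, for every table `0 ≤ c ≤ c₀` (`R₀ ≥ 6`), in either presentation of plate 2. -/
theorem bilayerWallAt_of_barlowDownCertifiedSteer {sE : E3} (hsE : sE ∈ fccSlots) (hcert : ExactOnly 0 (fccSlots.filter fun w => 0 < ⟪w, sE⟫_ℝ))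
    (hDS : ∀ F₁ F₂ : E3 ≃ₗᵢ[ℝ] E3, DoubleStarCoaxialAt F₁ F₂) (hCP : CapPairCoaxial)
    {σ₁ σ₂ : ℤ → ℤ} (hσ₁ : IsHaggSeq σ₁) (hσ₂ : IsHaggSeq σ₂) (L₁ L₂ : E3 ≃ₗᵢ[ℝ] E3) (s₁ s₂ : E3)
    {c₀ : ℝ} {z v : E3} (hcov : BarlowDownCertifiedSteer c₀ σ₂ L₁ L₂ z v) (R₀ : ℝ) (hR₀ : 6 ≤ R₀)
    (c : ℤ → ℤ → ℝ) (hc0 : ∀ i j, 0 ≤ c i j) (hcc : ∀ i j, c i j ≤ c₀) :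
    BilayerWallAt (((270 + 576 * R₀) + 80 * (R₀ + 9) + 3456 + 1152 * (R₀ + 1)) / 2) R₀ σ₁ σ₂ L₁ L₂ s₁ s₂ c := by
  obtain ⟨hz, hze, hv, hv2, hsteep, hrise, hnab, hapart⟩ := hcov
  have hR₀3 : (3 : ℝ) ≤ R₀ := by linarith
  by_cases hax : 0 ≤ (L₂.symm (-e₃)) 2
  · have hup : upFrame L₂ (-e₃) = L₂ := by unfold upFrame; rw [if_pos hax]
    have huw : upWord L₂ σ₂ (-e₃) = σ₂ := by unfold upWord; rw [if_pos hax]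
    rw [hup] at hsteep hrise hnab hapart
    rw [huw] at hnab
    obtain ⟨step₂, hupb, hΔ, hna, hr, hF⟩ := barlow_hlines_oriented_oneSided_top_at_tilt hsE hcert hDS hCP hσ₁ hσ₂ L₁ L₂ s₁ s₂ hax hz hze
      hv hv2 hsteep (fun m hm => (hnab m hm).1) hapart R₀ hR₀
    refine bilayerWallAt_of_lineCount_oneSided_up_top hσ₁ hσ₂ L₁ L₂ s₁ s₂ R₀ (270 + 576 * R₀) hR₀3 hax hupb hr c hc0 ?_ hF
    intro i j
    refine (hcc i j).trans ?_
    rcases hσ₂ j with h1 | h1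
    · rw [hΔ j h1, ← inner_map_eq_inner_symm]; exact le_sqrt_two_mul_div_two'' hrise
    · rw [hna j h1, ← inner_map_eq_inner_symm]; exact le_sqrt_two_mul_div_two'' (hnab j h1).2
  · have hup : upFrame L₂ (-e₃) = basalMirror.trans L₂ := by unfold upFrame; rw [if_neg hax]
    have huw : upWord L₂ σ₂ (-e₃) = fun n => -σ₂ (-n - 1) := by unfold upWord; rw [if_neg hax]
    rw [hup] at hsteep hrise hnab hapart
    rw [huw] at hnab
    have hσ₂' : IsHaggSeq (fun n => -σ₂ (-n - 1)) := isHaggSeq_reverse hσ₂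
    have hax' : 0 ≤ ((basalMirror.trans L₂).symm (-e₃)) 2 := by
      have h := upFrame_axis_nonneg L₂ (-e₃)
      rwa [hup] at h
    obtain ⟨step₂, hupb, hΔ, hna, hr, hF⟩ := barlow_hlines_oriented_oneSided_top_at_tilt hsE hcert hDS hCP hσ₁ hσ₂' L₁ (basalMirror.trans L₂)
      s₁ s₂ hax' hz hze hv hv2 hsteep (fun m hm => (hnab m hm).1) hapart R₀ hR₀
    have key := bilayerWallAt_of_lineCount_oneSided_up_top hσ₁ hσ₂' L₁ (basalMirror.trans L₂) s₁ s₂ R₀ (270 + 576 * R₀) hR₀3 hax' hupb hr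
      (fun i j => c i (-j - 1)) (fun i j => hc0 _ _) (fun i j => by
        refine (hcc _ _).trans ?_
        rcases hσ₂' j with h1 | h1
        · rw [hΔ j h1, ← inner_map_eq_inner_symm]; exact le_sqrt_two_mul_div_two'' hrise
        · rw [hna j h1, ← inner_map_eq_inner_symm]; exact le_sqrt_two_mul_div_two'' (hnab j h1).2) hF
    exact bilayerWallAt_flip₂.1 key

/-- **Steer-menu-certified ⇒ the cell** at the constant `max C(R₀) C′(R₀)` (`R₀ ≥ 6`). -/
theorem bilayerWallAt_of_barlowMenuSteerCertified {sE : E3} (hsE : sE ∈ fccSlots) (hcert : ExactOnly 0 (fccSlots.filter fun w => 0 < ⟪w, sE⟫_ℝ))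
    (hDS : ∀ F₁ F₂ : E3 ≃ₗᵢ[ℝ] E3, DoubleStarCoaxialAt F₁ F₂) (hCP : CapPairCoaxial)
    {σ₁ σ₂ : ℤ → ℤ} (hσ₁ : IsHaggSeq σ₁) (hσ₂ : IsHaggSeq σ₂) (L₁ L₂ : E3 ≃ₗᵢ[ℝ] E3) (s₁ s₂ : E3)
    {c₀ : ℝ} (hcov : BarlowMenuSteerCertified c₀ σ₁ σ₂ L₁ L₂) (R₀ : ℝ) (hR₀ : 6 ≤ R₀)
    (c : ℤ → ℤ → ℝ) (hc0 : ∀ i j, 0 ≤ c i j) (hcc : ∀ i j, c i j ≤ c₀) :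
    BilayerWallAt (max ((318 + 192 * R₀ + 80 * (R₀ + 9) + 3456 + 1152 * (R₀ + 1)) / 2)
      (((270 + 576 * R₀) + 80 * (R₀ + 9) + 3456 + 1152 * (R₀ + 1)) / 2)) R₀ σ₁ σ₂ L₁ L₂ s₁ s₂ c := by
  have hR₀0 : (0 : ℝ) ≤ R₀ := by linarith
  rcases hcov with hmenu | ⟨z, v, hup⟩ | ⟨z, v, hdown⟩
  · exact bilayerWallAt_mono hR₀0 (le_max_left _ _)
      (bilayerWallAt_of_barlowMenuCertified hsE hcert hDS hCP hσ₁ hσ₂ L₁ L₂ s₁ s₂ hmenu R₀ hR₀ c hc0 hcc)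
  · exact bilayerWallAt_mono hR₀0 (le_max_right _ _)
      (bilayerWallAt_of_barlowUpCertifiedSteer hsE hcert hDS hCP hσ₁ hσ₂ L₁ L₂ s₁ s₂ hup R₀ hR₀ c hc0 hcc)
  · exact bilayerWallAt_mono hR₀0 (le_max_right _ _)
      (bilayerWallAt_of_barlowDownCertifiedSteer hsE hcert hDS hCP hσ₁ hσ₂ L₁ L₂ s₁ s₂ hdown R₀ hR₀ c hc0 hcc)

/-! ## Steered certificate on `Reg` ⇒ the on-`Reg` law ⇒ the core -/

/-- **Steered certificate on `Reg` ⇒ `BilayerWallFaultedOnAt Reg c₀ (max C C′) R₀`** (`R₀ ≥ 6`). -/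
theorem faultedOnAt_of_steerCoverageBarlowOn {sE : E3} (hsE : sE ∈ fccSlots) (hcert : ExactOnly 0 (fccSlots.filter fun w => 0 < ⟪w, sE⟫_ℝ))
    (hDS : ∀ F₁ F₂ : E3 ≃ₗᵢ[ℝ] E3, DoubleStarCoaxialAt F₁ F₂) (hCP : CapPairCoaxial)
    {Reg : (ℤ → ℤ) → (ℤ → ℤ) → (E3 ≃ₗᵢ[ℝ] E3) → (E3 ≃ₗᵢ[ℝ] E3) → Prop} {c₀ : ℝ}
    (hcov : ResidualSteerCoverageBarlowOn Reg c₀) {R₀ : ℝ} (hR₀ : 6 ≤ R₀) :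
    BilayerWallFaultedOnAt Reg c₀ (max ((318 + 192 * R₀ + 80 * (R₀ + 9) + 3456 + 1152 * (R₀ + 1)) / 2)
      (((270 + 576 * R₀) + 80 * (R₀ + 9) + 3456 + 1152 * (R₀ + 1)) / 2)) R₀ := by
  intro σ₁ σ₂ hσ₁ hσ₂ hf L₁ L₂ s₁ s₂ A₁ A₂ u₁ u₂ _ _ hreg c m hadm
  exact bilayerWallAt_of_barlowMenuSteerCertified hsE hcert hDS hCP hσ₁ hσ₂ L₁ L₂ s₁ s₂ (hcov σ₁ σ₂ hσ₁ hσ₂ hf L₁ L₂ hreg)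
    R₀ hR₀ c hadm.1 hadm.2.1

/-- **THE ROW-(e) CLOSER OVER THE STEERED MENU, `ExactOnly` form** (`R₀ ≥ 6`). -/
theorem residualFaultedCoreAt_of_steerCoverageBarlowOn {sE : E3} (hsE : sE ∈ fccSlots)
    (hcert : ExactOnly 0 (fccSlots.filter fun w => 0 < ⟪w, sE⟫_ℝ))
    (hDS : ∀ F₁ F₂ : E3 ≃ₗᵢ[ℝ] E3, DoubleStarCoaxialAt F₁ F₂) (hCP : CapPairCoaxial)
    {Reg Rem : (ℤ → ℤ) → (ℤ → ℤ) → (E3 ≃ₗᵢ[ℝ] E3) → (E3 ≃ₗᵢ[ℝ] E3) → Prop}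
    (hcover : ∀ σ₁ σ₂ L₁ L₂, Reg σ₁ σ₂ L₁ L₂ ∨ Rem σ₁ σ₂ L₁ L₂) {c₀ : ℝ} (hcov : ResidualSteerCoverageBarlowOn Reg c₀)
    {R₀ : ℝ} (hR₀ : 6 ≤ R₀) (hrem : ∃ C : ℝ, BilayerWallResidualFaultedCoreOnAt Rem c₀ C R₀) :
    ∃ C : ℝ, BilayerWallResidualFaultedCoreAt c₀ C R₀ := by
  obtain ⟨C₂, h₂⟩ := hrem
  exact ⟨_, residualFaultedCoreAt_of_split hcover (by linarith) (faultedOnAt_of_steerCoverageBarlowOn hsE hcert hDS hCP hcov hR₀) h₂⟩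

/-- **THE ROW-(e) CLOSER OVER THE STEERED MENU, named-fact form**: `P5Exhaustion → StarPairFar → steered certificate on Reg → (∃ C, core on Rem) →
∃ C, core`, `Reg ∨ Rem` exhaustive (`R₀ ≥ 6`). -/
theorem residualFaultedCoreAt_of_steerCoverageBarlowOn' (hE1 : P5Exhaustion) (hSP : StarPairFar)
    {Reg Rem : (ℤ → ℤ) → (ℤ → ℤ) → (E3 ≃ₗᵢ[ℝ] E3) → (E3 ≃ₗᵢ[ℝ] E3) → Prop}
    (hcover : ∀ σ₁ σ₂ L₁ L₂, Reg σ₁ σ₂ L₁ L₂ ∨ Rem σ₁ σ₂ L₁ L₂) {c₀ : ℝ} (hcov : ResidualSteerCoverageBarlowOn Reg c₀)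
    {R₀ : ℝ} (hR₀ : 6 ≤ R₀) (hrem : ∃ C : ℝ, BilayerWallResidualFaultedCoreOnAt Rem c₀ C R₀) :
    ∃ C : ℝ, BilayerWallResidualFaultedCoreAt c₀ C R₀ := by
  obtain ⟨sE, hsE, hcert⟩ := exactOnly_star_of_p5Exhaustion hE1
  exact residualFaultedCoreAt_of_steerCoverageBarlowOn hsE hcert (doubleStarCoaxialAt_of_starPairFar hSP)
    (capPairCoaxial_of_starPairFar hSP) hcover hcov hR₀ hrem

end Summit.Ventures.Crystal3D.Cruxes.TextureLiminf.TexShadow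

end
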